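import Literature.AlgebraicGeometry.ShimuraVarieties.UnitaryShimuraCanonicalModel
import Mathlib.LinearAlgebra.CrossProduct
import HarnessLib

/-!
# An `H`-orthogonal `L`-frame of `V = L³` through an anisotropic vector

[Milne2005ShimuraVarieties] Def. 12.5 / Rem. 12.6 p. 113 («in every orthogonal basis `b = (v₁, v₂, v₃)`»);
[BergeronMillsonMoeglin2016Balls] Part 2 §1.1 (anisotropic hermitian spaces over a CM field).  For the tree's hermitian
datum `(L, H)` (`H ∈ M₃(L)` hermitian for the CM involution `c = cmConjRingHom L`, ★ `hermForm`) which is ANISOTROPIC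
(`⟨v,v⟩ = 0 ⇒ v = 0`) and a vector `v₃ ≠ 0`, there is an `H`-ORTHOGONAL basis `b = (v₁ | v₂ | v₃) ∈ GL₃(L)` of `V = L³` with
third vector `v₃` (`exists_orthogonalFrame`): Gram–Schmidt without division — `v₁ = ⟨v₃,v₃⟩·e_a − ⟨v₃,e_a⟩·v₃` for an index
`a` with `v₁ ≠ 0`, `v₂ =` the cross product of the two rows `ᵗc(v₃)·H`, `ᵗc(v₁)·H` (Mathlib ★ `crossProduct`), and `b` is
invertible because its Gram matrix `ᵗc(b)·H·b = diag(⟨v₁,v₁⟩, ⟨v₂,v₂⟩, ⟨v₃,v₃⟩)` is (anisotropy).  This is the frame in which the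
special pair of the line `L·v₃` is read ([Milne2005ShimuraVarieties] Def. 12.5; the tree's `IsDiagTwist`, `IsLinePoint`).
-/

noncomputable section

open Matrix NumberField
open scoped Matrix

namespace Literature.AlgebraicGeometry.ShimuraVarieties.UnitaryCanonicalModel

open Literature.NumberTheory.Automorphic Literature.NumberTheory.Automorphic.UnitaryGroup

section OrthogonalFrame

variable {L : Type} [Field L] [NumberField L] [IsCMField L]

/-- `⟨u, v⟩ = (ᵗc(u)·H) · v`: the hermitian form as the pairing of the row `ᵗc(u)·H` with `v`. [cite: BergeronMillsonMoeglin2016Balls, Part 2 §1.1] -/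
theorem hermForm_eq_vecMul_dotProduct (H : Matrix (Fin 3) (Fin 3) L) (u v : Fin 3 → L) :
    hermForm (cmConjRingHom L) H u v = ((cmConjRingHom L ∘ u) ᵥ* H) ⬝ᵥ v := by
  rw [hermForm, Matrix.dotProduct_mulVec]

/-- `⟨u, ·⟩` is additive. [cite: BergeronMillsonMoeglin2016Balls, Part 2 §1.1] -/
theorem hermForm_add_right (H : Matrix (Fin 3) (Fin 3) L) (u v w : Fin 3 → L) :
    hermForm (cmConjRingHom L) H u (v + w) = hermForm (cmConjRingHom L) H u v + hermForm (cmConjRingHom L) H u w := by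
  rw [hermForm, hermForm, hermForm, Matrix.mulVec_add, dotProduct_add]

/-- `⟨u, ·⟩` is homogeneous. [cite: BergeronMillsonMoeglin2016Balls, Part 2 §1.1] -/
theorem hermForm_smul_right (H : Matrix (Fin 3) (Fin 3) L) (u v : Fin 3 → L) (a : L) :
    hermForm (cmConjRingHom L) H u (a • v) = a * hermForm (cmConjRingHom L) H u v := by
  rw [hermForm, hermForm, Matrix.mulVec_smul, dotProduct_smul, smul_eq_mul]

/-- `⟨u, ·⟩` respects subtraction. [cite: BergeronMillsonMoeglin2016Balls, Part 2 §1.1] -/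
theorem hermForm_sub_right (H : Matrix (Fin 3) (Fin 3) L) (u v w : Fin 3 → L) :
    hermForm (cmConjRingHom L) H u (v - w) = hermForm (cmConjRingHom L) H u v - hermForm (cmConjRingHom L) H u w := by
  rw [hermForm, hermForm, hermForm, Matrix.mulVec_sub, dotProduct_sub]

/-- The Gram matrix of a frame: `(ᵗc(b)·H·b)_{kl} = ⟨b e_k, b e_l⟩`. [cite: BergeronMillsonMoeglin2016Balls, Part 2 §1.1] -/
theorem transpose_map_mul_mul_apply (H b : Matrix (Fin 3) (Fin 3) L) (k l : Fin 3) :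
    ((b.map (cmConjRingHom L))ᵀ * H * b) k l =
      hermForm (cmConjRingHom L) H (fun i => b i k) (fun i => b i l) := by
  rw [Matrix.mul_assoc, Matrix.mul_apply]
  rfl

/-- **An `H`-orthogonal frame through an anisotropic vector** ([Milne2005ShimuraVarieties] Def. 12.5 «in every orthogonal basis
`(v₁, v₂, v₃)`»): for `H` hermitian and anisotropic and `v₃ ≠ 0` there is `b ∈ GL₃(L)` with third column `v₃` and pairwise
`H`-orthogonal columns. [cite: Milne2005ShimuraVarieties, Def. 12.5 and Rem. 12.6 p. 113] [cite: BergeronMillsonMoeglin2016Balls, Part 2 §1.1] -/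
theorem exists_orthogonalFrame (H : Matrix (Fin 3) (Fin 3) L) (hH : ∀ i j, cmConjRingHom L (H i j) = H j i)
    (hanis : ∀ v : Fin 3 → L, hermForm (cmConjRingHom L) H v v = 0 → v = 0) (v₃ : Fin 3 → L) (hv₃ : v₃ ≠ 0) :
    ∃ b : GL (Fin 3) L, (∀ i, (b : Matrix (Fin 3) (Fin 3) L) i 2 = v₃ i) ∧
      ∀ k l : Fin 3, k ≠ l →
        hermForm (cmConjRingHom L) H (fun i => (b : Matrix (Fin 3) (Fin 3) L) i k)
          (fun i => (b : Matrix (Fin 3) (Fin 3) L) i l) = 0 := by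
  classical
  -- notation
  set σ := cmConjRingHom L with hσ
  have hcomm : ∀ v w, hermForm σ H v w = σ (hermForm σ H w v) := hermForm_comm H hH
  have hzero_symm : ∀ v w, hermForm σ H v w = 0 → hermForm σ H w v = 0 := fun v w h => by
    rw [hcomm, h, map_zero]
  set q := hermForm σ H v₃ v₃ with hq
  have hq0 : q ≠ 0 := fun h => hv₃ (hanis v₃ h)
  -- Step 1: a nonzero vector `u₁ ⊥ v₃`: `q·e_a − ⟨v₃,e_a⟩·v₃` for a suitable index `a`
  have hproj : ∀ u, hermForm σ H v₃ (q • u - hermForm σ H v₃ u • v₃) = 0 := fun u => by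
    rw [hermForm_sub_right, hermForm_smul_right, hermForm_smul_right, ← hq, mul_comm, sub_self]
  obtain ⟨a, ha⟩ : ∃ a : Fin 3, q • (Pi.single a (1 : L) : Fin 3 → L) - hermForm σ H v₃ (Pi.single a 1) • v₃ ≠ 0 := by
    by_contra hall
    rw [not_exists] at hall
    simp only [not_not, sub_eq_zero] at hall
    obtain ⟨k, hk⟩ : ∃ k, v₃ k ≠ 0 := by
      by_contra h'
      rw [not_exists] at h'
      exact hv₃ (funext fun k => not_not.mp (h' k))
    obtain ⟨a, hak⟩ : ∃ a : Fin 3, a ≠ k := ⟨k + 1, by fin_cases k <;> decide⟩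
    have h1 := congrFun (hall a) k
    simp only [Pi.smul_apply, Pi.single_eq_of_ne hak.symm, smul_eq_mul, mul_zero] at h1
    -- `0 = ⟨v₃,e_a⟩ * v₃ k` so `⟨v₃,e_a⟩ = 0`, whence `q • e_a = 0`, i.e. `q = 0`
    have hc : hermForm σ H v₃ (Pi.single a 1) = 0 := by
      rcases mul_eq_zero.mp h1.symm with h | h
      · exact h
      · exact absurd h hk
    have h2 := congrFun (hall a) a
    simp only [Pi.smul_apply, Pi.single_eq_same, smul_eq_mul, mul_one, hc, zero_mul] at h2
    exact hq0 h2
  set u₁ : Fin 3 → L := q • (Pi.single a (1 : L) : Fin 3 → L) - hermForm σ H v₃ (Pi.single a 1) • v₃ with hu₁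
  have h31 : hermForm σ H v₃ u₁ = 0 := hproj _
  have h13 : hermForm σ H u₁ v₃ = 0 := hzero_symm _ _ h31
  set q₁ := hermForm σ H u₁ u₁ with hq₁
  have hq₁0 : q₁ ≠ 0 := fun h => ha (hanis u₁ h)
  -- Step 2: `u₂ =` cross product of the rows `ᵗc(v₃)·H` and `ᵗc(u₁)·H`
  set r₃ : Fin 3 → L := (σ ∘ v₃) ᵥ* H with hr₃
  set r₁ : Fin 3 → L := (σ ∘ u₁) ᵥ* H with hr₁
  set u₂ : Fin 3 → L := r₃ ⨯₃ r₁ with hu₂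
  have h32 : hermForm σ H v₃ u₂ = 0 := by rw [hermForm_eq_vecMul_dotProduct, ← hr₃, hu₂, dot_self_cross]
  have h12 : hermForm σ H u₁ u₂ = 0 := by rw [hermForm_eq_vecMul_dotProduct, ← hr₁, hu₂, dot_cross_self]
  have h23 : hermForm σ H u₂ v₃ = 0 := hzero_symm _ _ h32
  have h21 : hermForm σ H u₂ u₁ = 0 := hzero_symm _ _ h12
  have hu₂0 : u₂ ≠ 0 := by
    rw [hu₂]
    refine crossProduct_ne_zero_iff_linearIndependent.mpr (LinearIndependent.pair_iff.mpr fun s t hst => ?_)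
    have hv : (s • r₃ + t • r₁) ⬝ᵥ v₃ = 0 := by rw [hst, zero_dotProduct]
    have hu : (s • r₃ + t • r₁) ⬝ᵥ u₁ = 0 := by rw [hst, zero_dotProduct]
    rw [add_dotProduct, smul_dotProduct, smul_dotProduct, hr₃, hr₁, ← hermForm_eq_vecMul_dotProduct,
      ← hermForm_eq_vecMul_dotProduct, smul_eq_mul, smul_eq_mul] at hv hu
    rw [h13, mul_zero, add_zero, ← hq] at hv
    rw [h31, mul_zero, zero_add, ← hq₁] at hu
    exact ⟨(mul_eq_zero.mp hv).resolve_right hq0, (mul_eq_zero.mp hu).resolve_right hq₁0⟩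
  set q₂ := hermForm σ H u₂ u₂ with hq₂
  have hq₂0 : q₂ ≠ 0 := fun h => hu₂0 (hanis u₂ h)
  -- Step 3: the frame and its Gram matrix
  set b : Matrix (Fin 3) (Fin 3) L := Matrix.of fun i k => (![u₁, u₂, v₃] : Fin 3 → Fin 3 → L) k i with hb
  have hcol : ∀ k, (fun i => b i k) = (![u₁, u₂, v₃] : Fin 3 → Fin 3 → L) k := fun k => rfl
  have horth : ∀ k l : Fin 3, k ≠ l → hermForm σ H (fun i => b i k) (fun i => b i l) = 0 := by
    intro k l hkl
    rw [hcol, hcol]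
    fin_cases k <;> fin_cases l
    all_goals (first | exact absurd rfl hkl | simp)
    all_goals first | exact h12 | exact h13 | exact h21 | exact h23 | exact h31 | exact h32
  have hgram : (b.map σ)ᵀ * H * b = Matrix.diagonal ![q₁, q₂, q] := by
    ext k l
    rw [transpose_map_mul_mul_apply]
    by_cases hkl : k = l
    · subst hkl
      rw [Matrix.diagonal_apply_eq, hcol]
      fin_cases k <;> rfl
    · rw [Matrix.diagonal_apply_ne _ hkl]
      exact horth k l hkl
  have hdet : b.det ≠ 0 := by
    intro h0
    have h1 : ((b.map σ)ᵀ * H * b).det = 0 := by rw [Matrix.det_mul, h0, mul_zero]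
    rw [hgram, Matrix.det_diagonal] at h1
    simp only [Fin.prod_univ_three, Matrix.cons_val_zero, Matrix.cons_val_one, Matrix.cons_val_two,
      Matrix.head_cons, Matrix.tail_cons, mul_eq_zero] at h1
    rcases h1 with (h1 | h1) | h1
    · exact hq₁0 h1
    · exact hq₂0 h1
    · exact hq0 h1
  refine ⟨Matrix.GeneralLinearGroup.mkOfDetNeZero b hdet, fun i => rfl, ?_⟩
  exact horth

end OrthogonalFrame

end Literature.AlgebraicGeometry.ShimuraVarieties.UnitaryCanonicalModel

end
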